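import Summits.QuantumFields.BalabanUV.Beta.CompositeMixedWardRootedDiv
import Summits.QuantumFields.BalabanUV.Beta.CompositeMixedTableGraded
import Summits.QuantumFields.BalabanUV.Beta.CompositeMixedWardRootedBricks

/-!
# `BalabanUV.Beta.CompositeMixedWardGraded` — row D1 ∕ (C1), PART 110e: THE SYMMETRISED MIXED WARD LAW OF THE **GRADED** COMPOSITE MIXED KERNEL CLOSES IN THE
# ORDINARY (FINEST-LEG) FORM AT EVERY DEPTH (generic bricks) — the j = 0 letter shape survives composition for `compMixKerG`

HONEST DEPENDENCY (page 1, mandatory): continuum YM on T⁴ ⇐ BetaPertH ∧ nine spine estimates (0/9 proved); BetaPertH ⇐ (D1) ∧ (D4) ∧ CAP+tail;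
G-an2-4 gates asym, D1 and NE2/3/4.  HONEST FRAMING (cell contract, verbatim): «discharging `BetaPertH` makes Bałaban's UV stability UNCONDITIONAL —
a real constructive-QFT result; it is NOT the continuum limit and NOT the Clay problem.»  ABSOLUTE RULE (cell charter, verbatim): «No internally-minted
statement may enter as a cited fact. Every hypothesis is either kernel-proved in this package or a verbatim quotation of a PUBLISHED theorem with page
reference. The manuscript(s) under audit are NOT citable for their own disputed steps — they are the thing under adjudication; programme-internal
(2001/route/tribunal) claims are never citable.»

WHY (row-D1 owner an2 gen 86, journal [AN2-G86-W-7]).  an2's `CompositeMixedTableGraded.compMixKerG` (2026-08-29; «the object the second-order Ward row `a2`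
is inhabited by, BY VALUE») is F6c's five-summand chain rule with the sign of the SECOND CROSS WORD flipped: `S1 + S2 − S3 + S4 + Σ ℓ·compMixKerG m`.  PART 110b
showed that for the UNGRADED `compMixKer` the `f ↔ f′`-symmetrised background Ward law holds only in «HG form» (generator at the Hessian brick's own-level
rooted legs).  THIS FILE: for the GRADED kernel the cross words no longer cancel under `f ↔ f′` but COMPLETE the top mixed brick's rooted-leg terms to the
finest-leg form, and the law closes by induction in the ORDINARY shape of an2 g21's one-step law:
**`compMixKerG_div_bg_symm`**: `Σ_κ [(compMixKerG m μ y (κ, z − e_κ) f f′ − compMixKerG m μ y (κ, z) f f′) + (f ↔ f′)] = 2 · compVHKer ℓ 𝒽 L m μ y f f′ · ([f′.2 = z] − [f.2 = z])`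
for ANY bricks under `hℓW`, `h𝓋W` (PART 105a), `h𝓉W` (PART 110a) and an antisymmetric `𝒽` — PART 110a's five divergences, `CompositeHessianTable.compVHKer_swap`,
`compVHKer_succ`.  So the (W)_j mixed letter's symmetrised kernel law in the j = 0 shape FOLLOWS at every depth for the graded kernel (rooted instance, hypothesis-free:
§2 `compMixKerG_div_bg_symm_rooted`, v2 APPEND = PART 110f, fed by PART 105a's and PART 110c's window laws).

WHAT: [folklore] finite-sum induction BY NAME over an2's `compLinKer ∕ compVHKer ∕ compMixKerG`; no `def`, no `def … : Prop`, nothing cited, 0 sorry.  Nothing of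
Bałaban's asserted, valued or discharged; 0 estimates; 0∕4 row-D1 binders; (W)_j NOT claimed (kernel-level symmetrised law only; remainder, bound, packing and the
record-level instantiation remain); NOT (C1), NOT D1, NEVER «G-an2-4 closed», NOT BetaPertH, NOT continuum, NOT Clay.  Row D1 ∕ (C1) OWNER «beta-an2», gen 86,
2026-08-30.  No existing file touched.
-/

noncomputable section

open Finset
open scoped BigOperators
open Literature.MathematicalPhysics.QuantumFieldTheory.Balaban1983to89
open Literature.MathematicalPhysics.QuantumFieldTheory.Balaban1983to89.Beta
open AffineAveraging (Site box toSite unitVec)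
open AveragingHessianKernels (Bond Near)
open Summit.QuantumFields.BalabanUV.Beta.CompositeVertexKernelRec
open Summit.QuantumFields.BalabanUV.Beta.CompositeMixedTableGraded (compMixKerG compMixKerG_zero compMixKerG_succ)
open Summit.QuantumFields.BalabanUV.Beta.CompositeHessianTable (compVHKer_swap)
open Summit.QuantumFields.BalabanUV.Beta.CompositeVertexWardRootedTwo (sum_pair_comm)
open Summit.QuantumFields.BalabanUV.Beta.CompositeMixedWardRootedDiv
open AveragingHessianKernelsRooted (linKerAt vhKerAt hessKerAt hessKerAt_swap)
open AveragingMixedJetTables (mixKerAt)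
open Summit.QuantumFields.BalabanUV.Beta.CompositeVertexWardRooted (linKerAt_window_dz vhKerAt_window_dz)
open Summit.QuantumFields.BalabanUV.Beta.CompositeMixedWardRootedBricks (mixKerAt_window_dz)

namespace Summit.QuantumFields.BalabanUV.Beta.CompositeMixedWardGraded

variable {d : ℕ}

section Generic

variable {ℓ : ℕ → Fin (d + 1) → Site (d + 1) → Bond (d + 1) → ℝ}
  {𝓋 𝒽 : ℕ → Fin (d + 1) → Site (d + 1) → Bond (d + 1) → Bond (d + 1) → ℝ}
  {𝓉 : ℕ → Fin (d + 1) → Site (d + 1) → Bond (d + 1) → Bond (d + 1) → Bond (d + 1) → ℝ} {L : ℕ}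
  {ρ : ℕ → Site (d + 1)} {R : ℕ → Site (d + 1)}
  (hR0 : R 0 = 0) (hRs : ∀ m : ℕ, R (m + 1) = R m + ((L ^ m : ℕ) : ℤ) • ρ m)
  (hℓW : ∀ (k : ℕ) (μ : Fin (d + 1)) (y : Site (d + 1)) (G : Site (d + 1) → ℝ),
    ∑ κ : Fin (d + 1), ∑ e ∈ offs L, ℓ k μ y (κ, (L : ℤ) • y + e) * (G ((L : ℤ) • y + e + unitVec κ) - G ((L : ℤ) • y + e)) =
      G ((L : ℤ) • y + ρ k + (L : ℤ) • unitVec μ) - G ((L : ℤ) • y + ρ k))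
  (h𝓋W : ∀ (k : ℕ) (μ : Fin (d + 1)) (y : Site (d + 1)) (f : Bond (d + 1)) (G : Site (d + 1) → ℝ),
    ∑ κ : Fin (d + 1), ∑ e ∈ offs L, 𝓋 k μ y f (κ, (L : ℤ) • y + e) * (G ((L : ℤ) • y + e + unitVec κ) - G ((L : ℤ) • y + e)) =
      (G ((L : ℤ) • y + ρ k) - G f.2) * ℓ k μ y f)
  (h𝓉W : ∀ (k : ℕ) (μ : Fin (d + 1)) (y : Site (d + 1)) (f f' : Bond (d + 1)) (G : Site (d + 1) → ℝ),
    ∑ κ : Fin (d + 1), ∑ e ∈ offs L, 𝓉 k μ y (κ, (L : ℤ) • y + e) f f' * (G ((L : ℤ) • y + e + unitVec κ) - G ((L : ℤ) • y + e)) =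
      2 * 𝒽 k μ y f f' * (G ((L : ℤ) • y + ρ k) - G f.2))
  (h𝒽a : ∀ (k : ℕ) (μ : Fin (d + 1)) (y : Site (d + 1)) (f f' : Bond (d + 1)), 𝒽 k μ y f' f = -𝒽 k μ y f f')

omit hR0 hRs hℓW h𝓋W h𝓉W h𝒽a in
/-- [folklore] summand 5 of the graded rule: the background divergence commuted inside the top linear brick. -/
theorem div_linMixedG (m : ℕ) (μ : Fin (d + 1)) (y : Site (d + 1)) (f f' : Bond (d + 1)) (z : Site (d + 1)) :
    ∑ κ₀ : Fin (d + 1),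
        ((∑ κ : Fin (d + 1), ∑ e ∈ offs L, ℓ m μ y (κ, (L : ℤ) • y + e) * compMixKerG ℓ 𝓋 𝒽 𝓉 L m κ ((L : ℤ) • y + e) (κ₀, z - unitVec κ₀) f f') -
          (∑ κ : Fin (d + 1), ∑ e ∈ offs L, ℓ m μ y (κ, (L : ℤ) • y + e) * compMixKerG ℓ 𝓋 𝒽 𝓉 L m κ ((L : ℤ) • y + e) (κ₀, z) f f')) =
      ∑ κ : Fin (d + 1), ∑ e ∈ offs L, ℓ m μ y (κ, (L : ℤ) • y + e) *
        ∑ κ₀ : Fin (d + 1), (compMixKerG ℓ 𝓋 𝒽 𝓉 L m κ ((L : ℤ) • y + e) (κ₀, z - unitVec κ₀) f f' -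
          compMixKerG ℓ 𝓋 𝒽 𝓉 L m κ ((L : ℤ) • y + e) (κ₀, z) f f') := by
  calc _ = ∑ κ₀ : Fin (d + 1), ∑ κ : Fin (d + 1), ∑ e ∈ offs L, ℓ m μ y (κ, (L : ℤ) • y + e) *
        (compMixKerG ℓ 𝓋 𝒽 𝓉 L m κ ((L : ℤ) • y + e) (κ₀, z - unitVec κ₀) f f' - compMixKerG ℓ 𝓋 𝒽 𝓉 L m κ ((L : ℤ) • y + e) (κ₀, z) f f') := by
        refine Finset.sum_congr rfl fun κ₀ _ => ?_
        simp only [← Finset.sum_sub_distrib, ← mul_sub]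
    _ = ∑ κ : Fin (d + 1), ∑ e ∈ offs L, ∑ κ₀ : Fin (d + 1), ℓ m μ y (κ, (L : ℤ) • y + e) *
        (compMixKerG ℓ 𝓋 𝒽 𝓉 L m κ ((L : ℤ) • y + e) (κ₀, z - unitVec κ₀) f f' - compMixKerG ℓ 𝓋 𝒽 𝓉 L m κ ((L : ℤ) • y + e) (κ₀, z) f f') := by
        rw [Finset.sum_comm]
        refine Finset.sum_congr rfl fun κ _ => ?_
        rw [Finset.sum_comm]
    _ = _ := by
        refine Finset.sum_congr rfl fun κ _ => Finset.sum_congr rfl fun e _ => ?_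
        rw [Finset.mul_sum]

include hR0 hRs hℓW h𝓋W h𝓉W h𝒽a in
/-- [folklore] **THE SYMMETRISED COMPOSITE MIXED WARD LAW OF THE GRADED KERNEL, ORDINARY FORM (kernel level, every depth)**: contracted with a fine pure gauge at the
site `z` in its BACKGROUND slot and symmetrised in its two fluctuation slots, the graded composite mixed kernel is twice the composite Hessian times the jump between
the two FINEST fluctuation legs — the shape of an2 g21's one-step law, at every depth:
`Σ_κ [(compMixKerG m μ y (κ, z − e_κ) f f′ − compMixKerG m μ y (κ, z) f f′) + (f ↔ f′)] = 2 · compVHKer ℓ 𝒽 L m μ y f f′ · ([f′.2 = z] − [f.2 = z])`. -/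
theorem compMixKerG_div_bg_symm (z : Site (d + 1)) : ∀ (m : ℕ) (μ : Fin (d + 1)) (y : Site (d + 1)) (f f' : Bond (d + 1)),
    ∑ κ₀ : Fin (d + 1), ((compMixKerG ℓ 𝓋 𝒽 𝓉 L m μ y (κ₀, z - unitVec κ₀) f f' - compMixKerG ℓ 𝓋 𝒽 𝓉 L m μ y (κ₀, z) f f') +
        (compMixKerG ℓ 𝓋 𝒽 𝓉 L m μ y (κ₀, z - unitVec κ₀) f' f - compMixKerG ℓ 𝓋 𝒽 𝓉 L m μ y (κ₀, z) f' f)) =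
      2 * compVHKer ℓ 𝒽 L m μ y f f' * ((if f'.2 = z then (1 : ℝ) else 0) - (if f.2 = z then (1 : ℝ) else 0))
  | 0, μ, y, f, f' => by
    simp only [compMixKerG_zero, compVHKer_zero, sub_self, add_zero, Finset.sum_const_zero, mul_zero, zero_mul]
  | m + 1, μ, y, f, f' => by
    have hIH := compMixKerG_div_bg_symm z m
    -- summands 1, 2, 3, both orders: the top mixed brick's rooted-leg terms are COMPLETED by the graded cross words to the finest-leg jump
    have hA : (∑ κ₁ : Fin (d + 1), ∑ e₁ ∈ offs L, ∑ κ₂ : Fin (d + 1), ∑ e₂ ∈ offs L,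
          compLinKer ℓ L m f (κ₁, (L : ℤ) • y + e₁) * compLinKer ℓ L m f' (κ₂, (L : ℤ) • y + e₂) *
            (2 * 𝒽 m μ y (κ₁, (L : ℤ) • y + e₁) (κ₂, (L : ℤ) • y + e₂) *
              ((if ((L ^ m : ℕ) : ℤ) • ((L : ℤ) • y + ρ m) + R m = z then (1 : ℝ) else 0) -
                (if ((L ^ m : ℕ) : ℤ) • ((L : ℤ) • y + e₁) + R m = z then (1 : ℝ) else 0)))) +
        (∑ κ₁ : Fin (d + 1), ∑ e₁ ∈ offs L, ∑ κ₂ : Fin (d + 1), ∑ e₂ ∈ offs L,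
          compLinKer ℓ L m f (κ₁, (L : ℤ) • y + e₁) * compLinKer ℓ L m f' (κ₂, (L : ℤ) • y + e₂) *
            (((if ((L ^ m : ℕ) : ℤ) • ((L : ℤ) • y + e₁) + R m = z then (1 : ℝ) else 0) - (if f.2 = z then (1 : ℝ) else 0)) *
              𝒽 m μ y (κ₁, (L : ℤ) • y + e₁) (κ₂, (L : ℤ) • y + e₂))) +
        (∑ κ₁ : Fin (d + 1), ∑ e₁ ∈ offs L, ∑ κ₂ : Fin (d + 1), ∑ e₂ ∈ offs L,
          compLinKer ℓ L m f (κ₁, (L : ℤ) • y + e₁) * compLinKer ℓ L m f' (κ₂, (L : ℤ) • y + e₂) *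
            (((if f'.2 = z then (1 : ℝ) else 0) - (if ((L ^ m : ℕ) : ℤ) • ((L : ℤ) • y + e₂) + R m = z then (1 : ℝ) else 0)) *
              𝒽 m μ y (κ₁, (L : ℤ) • y + e₁) (κ₂, (L : ℤ) • y + e₂))) +
        ((∑ κ₁ : Fin (d + 1), ∑ e₁ ∈ offs L, ∑ κ₂ : Fin (d + 1), ∑ e₂ ∈ offs L,
          compLinKer ℓ L m f' (κ₁, (L : ℤ) • y + e₁) * compLinKer ℓ L m f (κ₂, (L : ℤ) • y + e₂) *
            (2 * 𝒽 m μ y (κ₁, (L : ℤ) • y + e₁) (κ₂, (L : ℤ) • y + e₂) *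
              ((if ((L ^ m : ℕ) : ℤ) • ((L : ℤ) • y + ρ m) + R m = z then (1 : ℝ) else 0) -
                (if ((L ^ m : ℕ) : ℤ) • ((L : ℤ) • y + e₁) + R m = z then (1 : ℝ) else 0)))) +
        (∑ κ₁ : Fin (d + 1), ∑ e₁ ∈ offs L, ∑ κ₂ : Fin (d + 1), ∑ e₂ ∈ offs L,
          compLinKer ℓ L m f' (κ₁, (L : ℤ) • y + e₁) * compLinKer ℓ L m f (κ₂, (L : ℤ) • y + e₂) *
            (((if ((L ^ m : ℕ) : ℤ) • ((L : ℤ) • y + e₁) + R m = z then (1 : ℝ) else 0) - (if f'.2 = z then (1 : ℝ) else 0)) *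
              𝒽 m μ y (κ₁, (L : ℤ) • y + e₁) (κ₂, (L : ℤ) • y + e₂))) +
        (∑ κ₁ : Fin (d + 1), ∑ e₁ ∈ offs L, ∑ κ₂ : Fin (d + 1), ∑ e₂ ∈ offs L,
          compLinKer ℓ L m f' (κ₁, (L : ℤ) • y + e₁) * compLinKer ℓ L m f (κ₂, (L : ℤ) • y + e₂) *
            (((if f.2 = z then (1 : ℝ) else 0) - (if ((L ^ m : ℕ) : ℤ) • ((L : ℤ) • y + e₂) + R m = z then (1 : ℝ) else 0)) *
              𝒽 m μ y (κ₁, (L : ℤ) • y + e₁) (κ₂, (L : ℤ) • y + e₂)))) =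
        2 * (∑ κ₁ : Fin (d + 1), ∑ e₁ ∈ offs L, ∑ κ₂ : Fin (d + 1), ∑ e₂ ∈ offs L,
          𝒽 m μ y (κ₁, (L : ℤ) • y + e₁) (κ₂, (L : ℤ) • y + e₂) *
            compLinKer ℓ L m f (κ₁, (L : ℤ) • y + e₁) * compLinKer ℓ L m f' (κ₂, (L : ℤ) • y + e₂)) *
          ((if f'.2 = z then (1 : ℝ) else 0) - (if f.2 = z then (1 : ℝ) else 0)) := by
      rw [sum_pair_comm L (fun κ₁ e₁ κ₂ e₂ => compLinKer ℓ L m f' (κ₁, (L : ℤ) • y + e₁) * compLinKer ℓ L m f (κ₂, (L : ℤ) • y + e₂) *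
            (2 * 𝒽 m μ y (κ₁, (L : ℤ) • y + e₁) (κ₂, (L : ℤ) • y + e₂) *
              ((if ((L ^ m : ℕ) : ℤ) • ((L : ℤ) • y + ρ m) + R m = z then (1 : ℝ) else 0) -
                (if ((L ^ m : ℕ) : ℤ) • ((L : ℤ) • y + e₁) + R m = z then (1 : ℝ) else 0)))),
        sum_pair_comm L (fun κ₁ e₁ κ₂ e₂ => compLinKer ℓ L m f' (κ₁, (L : ℤ) • y + e₁) * compLinKer ℓ L m f (κ₂, (L : ℤ) • y + e₂) *
            (((if ((L ^ m : ℕ) : ℤ) • ((L : ℤ) • y + e₁) + R m = z then (1 : ℝ) else 0) - (if f'.2 = z then (1 : ℝ) else 0)) *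
              𝒽 m μ y (κ₁, (L : ℤ) • y + e₁) (κ₂, (L : ℤ) • y + e₂))),
        sum_pair_comm L (fun κ₁ e₁ κ₂ e₂ => compLinKer ℓ L m f' (κ₁, (L : ℤ) • y + e₁) * compLinKer ℓ L m f (κ₂, (L : ℤ) • y + e₂) *
            (((if f.2 = z then (1 : ℝ) else 0) - (if ((L ^ m : ℕ) : ℤ) • ((L : ℤ) • y + e₂) + R m = z then (1 : ℝ) else 0)) *
              𝒽 m μ y (κ₁, (L : ℤ) • y + e₁) (κ₂, (L : ℤ) • y + e₂)))]
      rw [Finset.mul_sum, Finset.sum_mul]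
      simp only [← Finset.sum_add_distrib]
      refine Finset.sum_congr rfl fun κ₁ _ => ?_
      rw [Finset.mul_sum, Finset.sum_mul]
      refine Finset.sum_congr rfl fun e₁ _ => ?_
      rw [Finset.mul_sum, Finset.sum_mul]
      refine Finset.sum_congr rfl fun κ₂ _ => ?_
      rw [Finset.mul_sum, Finset.sum_mul]
      refine Finset.sum_congr rfl fun e₂ _ => ?_
      rw [h𝒽a m μ y (κ₁, (L : ℤ) • y + e₁) (κ₂, (L : ℤ) • y + e₂)]
      ring
    -- summand 4, both orders: cancels by the antisymmetry of the composite Hessian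
    have hC : (∑ κ₁ : Fin (d + 1), ∑ e₁ ∈ offs L, compVHKer ℓ 𝒽 L m κ₁ ((L : ℤ) • y + e₁) f f' *
          (((if ((L ^ m : ℕ) : ℤ) • ((L : ℤ) • y + ρ m) + R m = z then (1 : ℝ) else 0) -
              (if ((L ^ m : ℕ) : ℤ) • ((L : ℤ) • y + e₁) + R m = z then (1 : ℝ) else 0)) * ℓ m μ y (κ₁, (L : ℤ) • y + e₁))) +
        (∑ κ₁ : Fin (d + 1), ∑ e₁ ∈ offs L, compVHKer ℓ 𝒽 L m κ₁ ((L : ℤ) • y + e₁) f' f *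
          (((if ((L ^ m : ℕ) : ℤ) • ((L : ℤ) • y + ρ m) + R m = z then (1 : ℝ) else 0) -
              (if ((L ^ m : ℕ) : ℤ) • ((L : ℤ) • y + e₁) + R m = z then (1 : ℝ) else 0)) * ℓ m μ y (κ₁, (L : ℤ) • y + e₁))) = 0 := by
      simp only [← Finset.sum_add_distrib]
      refine Finset.sum_eq_zero fun κ₁ _ => Finset.sum_eq_zero fun e₁ _ => ?_
      rw [compVHKer_swap h𝒽a m κ₁ ((L : ℤ) • y + e₁) f f']
      ring
    -- summand 5, both orders: the induction hypothesis under the top linear brick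
    have hD : (∑ κ : Fin (d + 1), ∑ e ∈ offs L, ℓ m μ y (κ, (L : ℤ) • y + e) *
          ∑ κ₀ : Fin (d + 1), (compMixKerG ℓ 𝓋 𝒽 𝓉 L m κ ((L : ℤ) • y + e) (κ₀, z - unitVec κ₀) f f' -
            compMixKerG ℓ 𝓋 𝒽 𝓉 L m κ ((L : ℤ) • y + e) (κ₀, z) f f')) +
        (∑ κ : Fin (d + 1), ∑ e ∈ offs L, ℓ m μ y (κ, (L : ℤ) • y + e) *
          ∑ κ₀ : Fin (d + 1), (compMixKerG ℓ 𝓋 𝒽 𝓉 L m κ ((L : ℤ) • y + e) (κ₀, z - unitVec κ₀) f' f -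
            compMixKerG ℓ 𝓋 𝒽 𝓉 L m κ ((L : ℤ) • y + e) (κ₀, z) f' f)) =
        2 * (∑ κ : Fin (d + 1), ∑ e ∈ offs L, ℓ m μ y (κ, (L : ℤ) • y + e) * compVHKer ℓ 𝒽 L m κ ((L : ℤ) • y + e) f f') *
          ((if f'.2 = z then (1 : ℝ) else 0) - (if f.2 = z then (1 : ℝ) else 0)) := by
      conv_rhs => rw [Finset.mul_sum, Finset.sum_mul]
      rw [← Finset.sum_add_distrib]
      refine Finset.sum_congr rfl fun κ _ => ?_
      conv_rhs => rw [Finset.mul_sum, Finset.sum_mul]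
      rw [← Finset.sum_add_distrib]
      refine Finset.sum_congr rfl fun e _ => ?_
      rw [← mul_add, ← Finset.sum_add_distrib, hIH κ ((L : ℤ) • y + e) f f']
      ring
    -- the reversed third group: `−(S3(z − e) − S3(z))` read through PART 110a's `div_hessRight`
    have hN : ∀ g g' : Bond (d + 1), ∑ κ₀ : Fin (d + 1),
        ((∑ κ₁ : Fin (d + 1), ∑ e₁ ∈ offs L, ∑ κ₂ : Fin (d + 1), ∑ e₂ ∈ offs L,
            𝒽 m μ y (κ₁, (L : ℤ) • y + e₁) (κ₂, (L : ℤ) • y + e₂)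
              * compLinKer ℓ L m g (κ₁, (L : ℤ) • y + e₁) * compVHKer ℓ 𝓋 L m κ₂ ((L : ℤ) • y + e₂) g' (κ₀, z)) -
          (∑ κ₁ : Fin (d + 1), ∑ e₁ ∈ offs L, ∑ κ₂ : Fin (d + 1), ∑ e₂ ∈ offs L,
            𝒽 m μ y (κ₁, (L : ℤ) • y + e₁) (κ₂, (L : ℤ) • y + e₂)
              * compLinKer ℓ L m g (κ₁, (L : ℤ) • y + e₁) * compVHKer ℓ 𝓋 L m κ₂ ((L : ℤ) • y + e₂) g' (κ₀, z - unitVec κ₀))) =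
        ∑ κ₁ : Fin (d + 1), ∑ e₁ ∈ offs L, ∑ κ₂ : Fin (d + 1), ∑ e₂ ∈ offs L,
          compLinKer ℓ L m g (κ₁, (L : ℤ) • y + e₁) * compLinKer ℓ L m g' (κ₂, (L : ℤ) • y + e₂) *
            (((if g'.2 = z then (1 : ℝ) else 0) - (if ((L ^ m : ℕ) : ℤ) • ((L : ℤ) • y + e₂) + R m = z then (1 : ℝ) else 0)) *
              𝒽 m μ y (κ₁, (L : ℤ) • y + e₁) (κ₂, (L : ℤ) • y + e₂)) := by
      intro g g'
      rw [← neg_inj, ← Finset.sum_neg_distrib]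
      simp only [neg_sub]
      rw [div_hessRight hR0 hRs hℓW h𝓋W (𝒽 := 𝒽) m μ y g g' z]
      simp only [← Finset.sum_neg_distrib]
      exact Finset.sum_congr rfl fun κ₁ _ => Finset.sum_congr rfl fun e₁ _ => Finset.sum_congr rfl fun κ₂ _ =>
        Finset.sum_congr rfl fun e₂ _ => by ring
    -- assemble
    calc ∑ κ₀ : Fin (d + 1), ((compMixKerG ℓ 𝓋 𝒽 𝓉 L (m + 1) μ y (κ₀, z - unitVec κ₀) f f' - compMixKerG ℓ 𝓋 𝒽 𝓉 L (m + 1) μ y (κ₀, z) f f') +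
          (compMixKerG ℓ 𝓋 𝒽 𝓉 L (m + 1) μ y (κ₀, z - unitVec κ₀) f' f - compMixKerG ℓ 𝓋 𝒽 𝓉 L (m + 1) μ y (κ₀, z) f' f))
        = ((∑ κ₁ : Fin (d + 1), ∑ e₁ ∈ offs L, ∑ κ₂ : Fin (d + 1), ∑ e₂ ∈ offs L,
              compLinKer ℓ L m f (κ₁, (L : ℤ) • y + e₁) * compLinKer ℓ L m f' (κ₂, (L : ℤ) • y + e₂) *
                (2 * 𝒽 m μ y (κ₁, (L : ℤ) • y + e₁) (κ₂, (L : ℤ) • y + e₂) *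
                  ((if ((L ^ m : ℕ) : ℤ) • ((L : ℤ) • y + ρ m) + R m = z then (1 : ℝ) else 0) -
                    (if ((L ^ m : ℕ) : ℤ) • ((L : ℤ) • y + e₁) + R m = z then (1 : ℝ) else 0)))) +
            (∑ κ₁ : Fin (d + 1), ∑ e₁ ∈ offs L, ∑ κ₂ : Fin (d + 1), ∑ e₂ ∈ offs L,
              compLinKer ℓ L m f (κ₁, (L : ℤ) • y + e₁) * compLinKer ℓ L m f' (κ₂, (L : ℤ) • y + e₂) *
                (((if ((L ^ m : ℕ) : ℤ) • ((L : ℤ) • y + e₁) + R m = z then (1 : ℝ) else 0) - (if f.2 = z then (1 : ℝ) else 0)) *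
                  𝒽 m μ y (κ₁, (L : ℤ) • y + e₁) (κ₂, (L : ℤ) • y + e₂))) +
            (∑ κ₁ : Fin (d + 1), ∑ e₁ ∈ offs L, ∑ κ₂ : Fin (d + 1), ∑ e₂ ∈ offs L,
              compLinKer ℓ L m f (κ₁, (L : ℤ) • y + e₁) * compLinKer ℓ L m f' (κ₂, (L : ℤ) • y + e₂) *
                (((if f'.2 = z then (1 : ℝ) else 0) - (if ((L ^ m : ℕ) : ℤ) • ((L : ℤ) • y + e₂) + R m = z then (1 : ℝ) else 0)) *
                  𝒽 m μ y (κ₁, (L : ℤ) • y + e₁) (κ₂, (L : ℤ) • y + e₂))) +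
            (∑ κ₁ : Fin (d + 1), ∑ e₁ ∈ offs L, compVHKer ℓ 𝒽 L m κ₁ ((L : ℤ) • y + e₁) f f' *
              (((if ((L ^ m : ℕ) : ℤ) • ((L : ℤ) • y + ρ m) + R m = z then (1 : ℝ) else 0) -
                  (if ((L ^ m : ℕ) : ℤ) • ((L : ℤ) • y + e₁) + R m = z then (1 : ℝ) else 0)) * ℓ m μ y (κ₁, (L : ℤ) • y + e₁))) +
            (∑ κ : Fin (d + 1), ∑ e ∈ offs L, ℓ m μ y (κ, (L : ℤ) • y + e) *
              ∑ κ₀ : Fin (d + 1), (compMixKerG ℓ 𝓋 𝒽 𝓉 L m κ ((L : ℤ) • y + e) (κ₀, z - unitVec κ₀) f f' -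
                compMixKerG ℓ 𝓋 𝒽 𝓉 L m κ ((L : ℤ) • y + e) (κ₀, z) f f'))) +
          ((∑ κ₁ : Fin (d + 1), ∑ e₁ ∈ offs L, ∑ κ₂ : Fin (d + 1), ∑ e₂ ∈ offs L,
              compLinKer ℓ L m f' (κ₁, (L : ℤ) • y + e₁) * compLinKer ℓ L m f (κ₂, (L : ℤ) • y + e₂) *
                (2 * 𝒽 m μ y (κ₁, (L : ℤ) • y + e₁) (κ₂, (L : ℤ) • y + e₂) *
                  ((if ((L ^ m : ℕ) : ℤ) • ((L : ℤ) • y + ρ m) + R m = z then (1 : ℝ) else 0) -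
                    (if ((L ^ m : ℕ) : ℤ) • ((L : ℤ) • y + e₁) + R m = z then (1 : ℝ) else 0)))) +
            (∑ κ₁ : Fin (d + 1), ∑ e₁ ∈ offs L, ∑ κ₂ : Fin (d + 1), ∑ e₂ ∈ offs L,
              compLinKer ℓ L m f' (κ₁, (L : ℤ) • y + e₁) * compLinKer ℓ L m f (κ₂, (L : ℤ) • y + e₂) *
                (((if ((L ^ m : ℕ) : ℤ) • ((L : ℤ) • y + e₁) + R m = z then (1 : ℝ) else 0) - (if f'.2 = z then (1 : ℝ) else 0)) *
                  𝒽 m μ y (κ₁, (L : ℤ) • y + e₁) (κ₂, (L : ℤ) • y + e₂))) +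
            (∑ κ₁ : Fin (d + 1), ∑ e₁ ∈ offs L, ∑ κ₂ : Fin (d + 1), ∑ e₂ ∈ offs L,
              compLinKer ℓ L m f' (κ₁, (L : ℤ) • y + e₁) * compLinKer ℓ L m f (κ₂, (L : ℤ) • y + e₂) *
                (((if f.2 = z then (1 : ℝ) else 0) - (if ((L ^ m : ℕ) : ℤ) • ((L : ℤ) • y + e₂) + R m = z then (1 : ℝ) else 0)) *
                  𝒽 m μ y (κ₁, (L : ℤ) • y + e₁) (κ₂, (L : ℤ) • y + e₂))) +
            (∑ κ₁ : Fin (d + 1), ∑ e₁ ∈ offs L, compVHKer ℓ 𝒽 L m κ₁ ((L : ℤ) • y + e₁) f' f *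
              (((if ((L ^ m : ℕ) : ℤ) • ((L : ℤ) • y + ρ m) + R m = z then (1 : ℝ) else 0) -
                  (if ((L ^ m : ℕ) : ℤ) • ((L : ℤ) • y + e₁) + R m = z then (1 : ℝ) else 0)) * ℓ m μ y (κ₁, (L : ℤ) • y + e₁))) +
            (∑ κ : Fin (d + 1), ∑ e ∈ offs L, ℓ m μ y (κ, (L : ℤ) • y + e) *
              ∑ κ₀ : Fin (d + 1), (compMixKerG ℓ 𝓋 𝒽 𝓉 L m κ ((L : ℤ) • y + e) (κ₀, z - unitVec κ₀) f' f -
                compMixKerG ℓ 𝓋 𝒽 𝓉 L m κ ((L : ℤ) • y + e) (κ₀, z) f' f))) := by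
          rw [← div_mixTop hR0 hRs hℓW h𝓉W m μ y f f' z, ← div_mixTop hR0 hRs hℓW h𝓉W m μ y f' f z,
            ← div_hessLeft hR0 hRs hℓW h𝓋W m μ y f f' z, ← div_hessLeft hR0 hRs hℓW h𝓋W m μ y f' f z,
            ← hN f f', ← hN f' f,
            ← div_vertHess hR0 hRs hℓW h𝓋W (𝒽 := 𝒽) m μ y f f' z, ← div_vertHess hR0 hRs hℓW h𝓋W (𝒽 := 𝒽) m μ y f' f z,
            ← div_linMixedG (ℓ := ℓ) (𝓋 := 𝓋) (𝒽 := 𝒽) (𝓉 := 𝓉) (L := L) m μ y f f' z,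
            ← div_linMixedG (ℓ := ℓ) (𝓋 := 𝓋) (𝒽 := 𝒽) (𝓉 := 𝓉) (L := L) m μ y f' f z]
          simp only [← Finset.sum_add_distrib]
          refine Finset.sum_congr rfl fun κ₀ _ => ?_
          rw [compMixKerG_succ, compMixKerG_succ, compMixKerG_succ, compMixKerG_succ]
          ring
      _ = 2 * (∑ κ₁ : Fin (d + 1), ∑ e₁ ∈ offs L, ∑ κ₂ : Fin (d + 1), ∑ e₂ ∈ offs L,
            𝒽 m μ y (κ₁, (L : ℤ) • y + e₁) (κ₂, (L : ℤ) • y + e₂) *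
              compLinKer ℓ L m f (κ₁, (L : ℤ) • y + e₁) * compLinKer ℓ L m f' (κ₂, (L : ℤ) • y + e₂)) *
            ((if f'.2 = z then (1 : ℝ) else 0) - (if f.2 = z then (1 : ℝ) else 0)) +
          2 * (∑ κ : Fin (d + 1), ∑ e ∈ offs L, ℓ m μ y (κ, (L : ℤ) • y + e) * compVHKer ℓ 𝒽 L m κ ((L : ℤ) • y + e) f f') *
            ((if f'.2 = z then (1 : ℝ) else 0) - (if f.2 = z then (1 : ℝ) else 0)) := by
          linear_combination hA + hC + hD
      _ = _ := by
          rw [compVHKer_succ]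
          ring

end Generic

/-! ## §2 The rooted instance, hypothesis-free (v2 APPEND, PART 110f) -/

section Rooted

variable {L : ℕ}

/-- [folklore] **THE SYMMETRISED MIXED WARD LAW OF THE GRADED COMPOSITE MIXED KERNEL OVER an1's ROOTED BRICKS, ORDINARY FORM, EVERY DEPTH, HYPOTHESIS-FREE**
(bricks `linKerAt ∕ vhKerAt ∕ hessKerAt ∕ mixKerAt (toSite (r k)) L`, in-block roots, `1 ≤ L`; the window laws from PART 105a `linKerAt_window_dz` ∕ `vhKerAt_window_dz`,
PART 110c `mixKerAt_window_dz`, antisymmetry `hessKerAt_swap`; composed root `R m = Σ_{k<m} L^k • toSite (r k)`, which the finest-leg form does not even see):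
`Σ_κ [(compMixKerG m μ y (κ, z − e_κ) f f′ − compMixKerG m μ y (κ, z) f f′) + (f ↔ f′)] = 2 · compVHKer ℓ 𝒽 L m μ y f f′ · ([f′.2 = z] − [f.2 = z])`. -/
theorem compMixKerG_div_bg_symm_rooted (hL : 1 ≤ L) {r : ℕ → Fin (d + 1) → ℕ} (hr : ∀ k, r k ∈ box (d + 1) L) (z : Site (d + 1)) (m : ℕ)
    (μ : Fin (d + 1)) (y : Site (d + 1)) (f f' : Bond (d + 1)) :
    ∑ κ₀ : Fin (d + 1),
        ((compMixKerG (fun k => linKerAt (toSite (r k)) L) (fun k => vhKerAt (toSite (r k)) L) (fun k => hessKerAt (toSite (r k)) L)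
              (fun k => mixKerAt (toSite (r k)) L) L m μ y (κ₀, z - unitVec κ₀) f f' -
            compMixKerG (fun k => linKerAt (toSite (r k)) L) (fun k => vhKerAt (toSite (r k)) L) (fun k => hessKerAt (toSite (r k)) L)
              (fun k => mixKerAt (toSite (r k)) L) L m μ y (κ₀, z) f f') +
          (compMixKerG (fun k => linKerAt (toSite (r k)) L) (fun k => vhKerAt (toSite (r k)) L) (fun k => hessKerAt (toSite (r k)) L)
              (fun k => mixKerAt (toSite (r k)) L) L m μ y (κ₀, z - unitVec κ₀) f' f -
            compMixKerG (fun k => linKerAt (toSite (r k)) L) (fun k => vhKerAt (toSite (r k)) L) (fun k => hessKerAt (toSite (r k)) L)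
              (fun k => mixKerAt (toSite (r k)) L) L m μ y (κ₀, z) f' f)) =
      2 * compVHKer (fun k => linKerAt (toSite (r k)) L) (fun k => hessKerAt (toSite (r k)) L) L m μ y f f' *
        ((if f'.2 = z then (1 : ℝ) else 0) - (if f.2 = z then (1 : ℝ) else 0)) :=
  compMixKerG_div_bg_symm (ρ := fun k => toSite (r k)) (R := fun m => ∑ i ∈ Finset.range m, ((L ^ i : ℕ) : ℤ) • toSite (r i))
    (by simp) (fun m => by rw [Finset.sum_range_succ]) (fun k μ y G => linKerAt_window_dz hL (hr k) μ y G)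
    (fun k μ y f G => vhKerAt_window_dz hL (hr k) μ y f G) (fun k μ y f f' G => mixKerAt_window_dz hL (hr k) μ y f f' G)
    (fun k μ y f f' => hessKerAt_swap (toSite (r k)) L μ y f f') z m μ y f f'

end Rooted

end Summit.QuantumFields.BalabanUV.Beta.CompositeMixedWardGraded

end
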